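import Mathlib
import Summits.AtomisticToContinuum.FouriersLaw.Theorems.EmbeddedDrudeMourreDrudeDissolutionFluxPointwise
import HarnessLib

/-!
# Smooth cutoffs at scale `η` around the zero set of a "squared distance"
(crux `EmbeddedDrudeMourre.DrudeDissolution`, item stmt-AtomisticToContinuum-12593; `--supports` file for the
registered sub-goal `exists_cutoff_profile` of stub B1b″ `stub_excursionSecondDifference` of line
`kinetic-polymer-gas-on-the-time-axis`; closes nothing; lead c13 (process B), 2026-08-17)

WHAT. (1) A cutoff PROFILE: a `C²` function `ζ : ℝ → ℝ` with `0 ≤ ζ ≤ 1`, `ζ = 0` on `(−∞,1]`, `ζ = 1` on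
`[4,∞)`, whose first two derivatives are bounded and vanish off `(1,4)` (`exists_cutoff_profile`, from
Mathlib's `Real.smoothTransition`). (2) The SCALED CUTOFF `Θ(p) = ζ(ρ(p)/η²)` around the zero set of a
nonnegative `C²` function `ρ` on a normed space ("squared distance": `(∂ρ)² ≤ Kρ`, `|∂²ρ| ≤ K₂` along the
directions used): `Θ = 0` where `ρ ≤ η²`, `Θ = 1` where `4η² ≤ ρ`, and
`|∂Θ| ≤ 2Z₁√K/η`, `|∂∂Θ| ≤ (4Z₂K + Z₁K₂)/η²` EVERYWHERE (`cutoff_scale_bounds_gen`, any real normed space).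

WHY (role). In the sup-norm route to B1b″ the amplitude fed to the `O(δ²)` engine is `W·Π Θ_k` with
`Θ_k = ζ(ρ_k/η²)` for the five squared distances `S₁²+A²`, `S₂²+A²`, `S₁²+S₂²`, `d²_{E±}` to the critical
curves and corners of `Ω`; the bounds `η⁻¹`, `η⁻²` above are the cutoff contributions to `g₁`, `g₂` in
`flux_pointwise_bound`, and `ρ ≤ 4η²` on the transition shells is what makes `W ≲ η²` there.
-/

noncomputable section

open Set Filter Function Topology
open scoped Topology

namespace Summit.AtomisticToContinuum.FouriersLaw.Theorems.DrudeDissolution.KineticPolymerGasOnTheTimeAxis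

/-! ### §1 The profile -/

/-- A continuous function on `ℝ` that vanishes off `[a, b]` is bounded. [folklore] -/
theorem exists_bound_of_continuous_of_eq_zero_off {g : ℝ → ℝ} (hg : Continuous g) {a b : ℝ}
    (h : ∀ t, t ∉ Set.Icc a b → g t = 0) : ∃ C, ∀ t, |g t| ≤ C := by
  obtain ⟨C, hC⟩ := isCompact_Icc.exists_bound_of_continuousOn (f := g) (s := Set.Icc a b) hg.continuousOn
  refine ⟨max C 0, fun t => ?_⟩
  by_cases ht : t ∈ Set.Icc a b
  · exact ((Real.norm_eq_abs _).symm.le.trans (hC t ht)).trans (le_max_left _ _)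
  · rw [h t ht, abs_zero]; exact le_max_right _ _

/-- **The cutoff profile.** There is a `C²` function `ζ : ℝ → ℝ` with `0 ≤ ζ ≤ 1`, `ζ = 0` on `(−∞, 1]`,
`ζ = 1` on `[4, ∞)`, with `|ζ′| ≤ Z₁`, `|ζ″| ≤ Z₂` everywhere and `ζ′ = ζ″ = 0` off `(1, 4)`
(`ζ(t) = smoothTransition((t−1)/3)`). [folklore] -/
theorem exists_cutoff_profile :
    ∃ ζ : ℝ → ℝ, ContDiff ℝ 2 ζ ∧ (∀ t, 0 ≤ ζ t ∧ ζ t ≤ 1) ∧ (∀ t, t ≤ 1 → ζ t = 0) ∧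
      (∀ t, 4 ≤ t → ζ t = 1) ∧
      (∀ t, (t < 1 ∨ 4 < t) → deriv ζ t = 0 ∧ deriv (deriv ζ) t = 0) ∧
      ∃ Z₁ Z₂ : ℝ, ∀ t, |deriv ζ t| ≤ Z₁ ∧ |deriv (deriv ζ) t| ≤ Z₂ := by
  set ζ : ℝ → ℝ := fun t => Real.smoothTransition ((t - 1) / 3) with hζ
  have haff : ContDiff ℝ 2 fun t : ℝ => (t - 1) / 3 := by fun_prop
  have hζC : ContDiff ℝ 2 ζ := Real.smoothTransition.contDiff.comp haff
  have hζ0 : ∀ t, t ≤ 1 → ζ t = 0 := fun t ht =>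
    Real.smoothTransition.zero_of_nonpos (by linarith)
  have hζ1 : ∀ t, 4 ≤ t → ζ t = 1 := fun t ht =>
    Real.smoothTransition.one_of_one_le (by linarith)
  -- derivatives: continuity
  have h11 : ContDiff ℝ (1 + 1) ζ := by rw [show ((1 : WithTop ℕ∞) + 1) = 2 by norm_num]; exact hζC
  have hd1 : ContDiff ℝ 1 (deriv ζ) := ((contDiff_succ_iff_deriv (n := 1)).1 h11).2.2
  have hd1c : Continuous (deriv ζ) := hd1.continuous
  have hd2c : Continuous (deriv (deriv ζ)) := by
    have h01 : ContDiff ℝ (0 + 1) (deriv ζ) := by rw [show ((0 : WithTop ℕ∞) + 1) = 1 by norm_num]; exact hd1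
    exact ((contDiff_succ_iff_deriv (n := 0)).1 h01).2.2.continuous
  -- derivatives vanish where `ζ` is locally constant
  have hconst : ∀ t, (t < 1 ∨ 4 < t) → ∃ c : ℝ, ζ =ᶠ[𝓝 t] fun _ => c := by
    intro t ht
    rcases ht with ht | ht
    · refine ⟨0, ?_⟩
      filter_upwards [Iio_mem_nhds ht] with s hs
      exact hζ0 s (le_of_lt hs)
    · refine ⟨1, ?_⟩
      filter_upwards [Ioi_mem_nhds ht] with s hs
      exact hζ1 s (le_of_lt hs)
  have hder0 : ∀ t, (t < 1 ∨ 4 < t) → deriv ζ t = 0 ∧ deriv (deriv ζ) t = 0 := by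
    intro t ht
    -- `deriv ζ = 0` on the open set `{t < 1} ∪ {4 < t}`, hence also `deriv (deriv ζ) t = 0`
    have hopen : ∀ᶠ s in 𝓝 t, s < 1 ∨ 4 < s := by
      rcases ht with ht | ht
      · filter_upwards [Iio_mem_nhds ht] with s hs using Or.inl hs
      · filter_upwards [Ioi_mem_nhds ht] with s hs using Or.inr hs
    have hd0 : ∀ s, (s < 1 ∨ 4 < s) → deriv ζ s = 0 := by
      intro s hs
      obtain ⟨c, hc⟩ := hconst s hs
      rw [hc.deriv_eq]; exact deriv_const s c
    refine ⟨hd0 t ht, ?_⟩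
    have hev : deriv ζ =ᶠ[𝓝 t] fun _ => (0 : ℝ) := hopen.mono fun s hs => hd0 s hs
    rw [hev.deriv_eq]; exact deriv_const t (0 : ℝ)
  -- bounds
  have hout : ∀ t, t ∉ Set.Icc (1 : ℝ) 4 → t < 1 ∨ 4 < t := fun t ht => by
    rcases lt_or_ge t 1 with h | h
    · exact Or.inl h
    · exact Or.inr (lt_of_not_ge fun h4 => ht ⟨h, h4⟩)
  have hoff1 : ∀ t, t ∉ Set.Icc (1 : ℝ) 4 → deriv ζ t = 0 := fun t ht => (hder0 t (hout t ht)).1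
  have hoff2 : ∀ t, t ∉ Set.Icc (1 : ℝ) 4 → deriv (deriv ζ) t = 0 := fun t ht => (hder0 t (hout t ht)).2
  obtain ⟨Z₁, hZ₁⟩ := exists_bound_of_continuous_of_eq_zero_off hd1c hoff1
  obtain ⟨Z₂, hZ₂⟩ := exists_bound_of_continuous_of_eq_zero_off hd2c hoff2
  exact ⟨ζ, hζC, fun t => ⟨Real.smoothTransition.nonneg _, Real.smoothTransition.le_one _⟩, hζ0, hζ1,
    hder0, Z₁, Z₂, fun t => ⟨hZ₁ t, hZ₂ t⟩⟩

/-! ### §2 The scaled cutoff `Θ = ζ(ρ/η²)` -/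

variable {V : Type*} [NormedAddCommGroup V] [NormedSpace ℝ V]

/-- Chain rule for `ζ ∘ (ρ/η²)` along a direction. [folklore] -/
theorem cutoff_fderiv_apply {ζ : ℝ → ℝ} (hζ : Differentiable ℝ ζ) {ρ : V → ℝ} (hρ : Differentiable ℝ ρ)
    (η : ℝ) (p e : V) :
    fderiv ℝ (fun q => ζ (ρ q / η ^ 2)) p e = deriv ζ (ρ p / η ^ 2) * (fderiv ℝ ρ p e / η ^ 2) := by
  have hin : HasFDerivAt (fun q => ρ q / η ^ 2) ((η ^ 2)⁻¹ • fderiv ℝ ρ p) p := by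
    have := (hρ p).hasFDerivAt.const_mul (η ^ 2)⁻¹
    simpa only [div_eq_inv_mul] using this
  have h : HasFDerivAt (fun q => ζ (ρ q / η ^ 2))
      (deriv ζ (ρ p / η ^ 2) • (η ^ 2)⁻¹ • fderiv ℝ ρ p) p :=
    (hζ (ρ p / η ^ 2)).hasDerivAt.comp_hasFDerivAt p hin
  rw [h.fderiv]
  simp only [FunLike.coe_smul, Pi.smul_apply, smul_eq_mul]
  ring

/-- `|a|·|b| ≤ 4Kη²` when `a², b² ≤ K·ρ` and `ρ ≤ 4η²`. [folklore] -/
theorem abs_mul_abs_le_of_sq_le {a b K ρ η : ℝ} (hK : 0 ≤ K) (ha : a ^ 2 ≤ K * ρ) (hb : b ^ 2 ≤ K * ρ)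
    (hρ : ρ ≤ 4 * η ^ 2) : |a| * |b| ≤ 4 * K * η ^ 2 := by
  have h1 : |a| * |b| ≤ (a ^ 2 + b ^ 2) / 2 := by
    have := two_mul_le_add_sq |a| |b|
    rw [sq_abs, sq_abs] at this
    linarith
  have h2 : a ^ 2 + b ^ 2 ≤ 2 * (K * ρ) := by linarith
  have h3 : K * ρ ≤ K * (4 * η ^ 2) := mul_le_mul_of_nonneg_left hρ hK
  linarith

/-- **The scaled cutoff: support properties and derivative bounds along two directions (general normed
space).** Let `ζ` be a profile as in `exists_cutoff_profile` (only the listed properties are used), `ρ` a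
`C²` function, `η > 0`, `e, e'` directions and `p` a point with `(∂ₑρ p)² ≤ K ρ p`,
`(∂ₑ'ρ p)² ≤ K ρ p`, `|∂ₑ'∂ₑρ p| ≤ K₂`. Then for `Θ = ζ(ρ/η²)`: `Θ p = 0` if `ρ p ≤ η²`, `Θ p = 1` if
`4η² ≤ ρ p`, `0 ≤ Θ p ≤ 1`, `|∂ₑΘ p| ≤ 2Z₁√K/η` and `|∂ₑ'∂ₑΘ p| ≤ (4Z₂K + Z₁K₂)/η²`. [folklore] -/
theorem cutoff_scale_bounds_gen {ζ : ℝ → ℝ} (hζ : ContDiff ℝ 2 ζ) (hζ01 : ∀ t, 0 ≤ ζ t ∧ ζ t ≤ 1)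
    (hζ0 : ∀ t, t ≤ 1 → ζ t = 0) (hζ1 : ∀ t, 4 ≤ t → ζ t = 1)
    (hζd0 : ∀ t, (t < 1 ∨ 4 < t) → deriv ζ t = 0 ∧ deriv (deriv ζ) t = 0)
    {Z₁ Z₂ : ℝ} (hZ : ∀ t, |deriv ζ t| ≤ Z₁ ∧ |deriv (deriv ζ) t| ≤ Z₂)
    {ρ : V → ℝ} (hρ : ContDiff ℝ 2 ρ) {η K K₂ : ℝ} (hη : 0 < η) (hK : 0 ≤ K) (e e' : V) (p : V)
    (hρ1 : (fderiv ℝ ρ p e) ^ 2 ≤ K * ρ p) (hρ1' : (fderiv ℝ ρ p e') ^ 2 ≤ K * ρ p)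
    (hρ2 : |fderiv ℝ (fun q => fderiv ℝ ρ q e) p e'| ≤ K₂) :
    (ρ p ≤ η ^ 2 → ζ (ρ p / η ^ 2) = 0) ∧ (4 * η ^ 2 ≤ ρ p → ζ (ρ p / η ^ 2) = 1) ∧
      (0 ≤ ζ (ρ p / η ^ 2) ∧ ζ (ρ p / η ^ 2) ≤ 1) ∧
      |fderiv ℝ (fun q => ζ (ρ q / η ^ 2)) p e| ≤ 2 * Z₁ * Real.sqrt K / η ∧
      |fderiv ℝ (fun q => fderiv ℝ (fun r => ζ (ρ r / η ^ 2)) q e) p e'| ≤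
        (4 * Z₂ * K + Z₁ * K₂) / η ^ 2 := by
  have hη2 : 0 < η ^ 2 := pow_pos hη 2
  have hZ₁ : 0 ≤ Z₁ := (abs_nonneg _).trans (hZ 0).1
  have hZ₂ : 0 ≤ Z₂ := (abs_nonneg _).trans (hZ 0).2
  have hK₂ : 0 ≤ K₂ := (abs_nonneg _).trans hρ2
  have hζd : Differentiable ℝ ζ := hζ.differentiable (by norm_num)
  have h11 : ContDiff ℝ (1 + 1) ζ := by rw [show ((1 : WithTop ℕ∞) + 1) = 2 by norm_num]; exact hζ
  have hζ' : ContDiff ℝ 1 (deriv ζ) := ((contDiff_succ_iff_deriv (n := 1)).1 h11).2.2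
  have hζ'd : Differentiable ℝ (deriv ζ) := hζ'.differentiable one_ne_zero
  have hρd : Differentiable ℝ ρ := hρ.differentiable (by norm_num)
  -- shell dichotomy: on `{1 < ρ/η² < 4}` we have `ρ ≤ 4η²`; off it `ζ' = ζ'' = 0`
  have hdich : ρ p ≤ 4 * η ^ 2 ∨ (deriv ζ (ρ p / η ^ 2) = 0 ∧ deriv (deriv ζ) (ρ p / η ^ 2) = 0) := by
    by_cases h4 : ρ p ≤ 4 * η ^ 2
    · exact Or.inl h4
    · refine Or.inr (hζd0 _ (Or.inr ?_))
      rw [lt_div_iff₀ hη2]; linarith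
  refine ⟨fun h => hζ0 _ ((div_le_one hη2).2 h), fun h => hζ1 _ ?_, hζ01 _, ?_, ?_⟩
  · rw [le_div_iff₀ hη2]; linarith
  · -- first derivative
    rw [cutoff_fderiv_apply hζd hρd η p e, abs_mul, abs_div, abs_of_pos hη2]
    rcases hdich with hρle | ⟨h0, -⟩
    · have hd : |fderiv ℝ ρ p e| ≤ 2 * Real.sqrt K * η := by
        have h1 : (fderiv ℝ ρ p e) ^ 2 ≤ (2 * Real.sqrt K * η) ^ 2 := by
          calc (fderiv ℝ ρ p e) ^ 2 ≤ K * ρ p := hρ1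
            _ ≤ K * (4 * η ^ 2) := by gcongr
            _ = (2 * Real.sqrt K * η) ^ 2 := by rw [mul_pow, mul_pow, Real.sq_sqrt hK]; ring
        exact (pow_le_pow_iff_left₀ (abs_nonneg _) (by positivity) two_ne_zero).1 (by rwa [sq_abs])
      calc |deriv ζ (ρ p / η ^ 2)| * (|fderiv ℝ ρ p e| / η ^ 2)
          ≤ Z₁ * (2 * Real.sqrt K * η / η ^ 2) := by
            gcongr; exact (hZ _).1
        _ = 2 * Z₁ * Real.sqrt K / η := by field_simp
    · rw [h0, abs_zero, zero_mul]; positivity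
  · -- second derivative of `q ↦ ζ'(ρ q/η²) · (∂ₑρ q / η²)`
    have hfun : (fun q => fderiv ℝ (fun r => ζ (ρ r / η ^ 2)) q e) =
        fun q => deriv ζ (ρ q / η ^ 2) * ((η ^ 2)⁻¹ * fderiv ℝ ρ q e) :=
      funext fun q => by rw [cutoff_fderiv_apply hζd hρd η q e]; ring
    rw [hfun]
    have hin : Differentiable ℝ fun q => ρ q / η ^ 2 := by
      simp_rw [div_eq_mul_inv]; exact hρd.mul_const _
    have hA : DifferentiableAt ℝ (fun q => deriv ζ (ρ q / η ^ 2)) p := (hζ'd _).comp p (hin p)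
    have hρe : DifferentiableAt ℝ (fun q => fderiv ℝ ρ q e) p :=
      (((hρ.fderiv_right (m := 1) (by norm_num)).differentiable one_ne_zero) p).clm_apply
        (differentiableAt_const e)
    have hB : DifferentiableAt ℝ (fun q => (η ^ 2)⁻¹ * fderiv ℝ ρ q e) p := hρe.const_mul _
    rw [fp_mul hA hB]
    have hA' : fderiv ℝ (fun q => deriv ζ (ρ q / η ^ 2)) p e' =
        deriv (deriv ζ) (ρ p / η ^ 2) * (fderiv ℝ ρ p e' / η ^ 2) :=
      cutoff_fderiv_apply hζ'd hρd η p e'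
    have hB' : fderiv ℝ (fun q => (η ^ 2)⁻¹ * fderiv ℝ ρ q e) p e' =
        (η ^ 2)⁻¹ * fderiv ℝ (fun q => fderiv ℝ ρ q e) p e' := by
      rw [fp_mul (differentiableAt_const _) hρe]; simp
    rw [hA', hB']
    -- bound the two terms
    have hT2 : |deriv ζ (ρ p / η ^ 2) * ((η ^ 2)⁻¹ * fderiv ℝ (fun q => fderiv ℝ ρ q e) p e')| ≤
        Z₁ * K₂ / η ^ 2 := by
      rw [abs_mul, abs_mul, abs_inv, abs_of_pos hη2]
      calc |deriv ζ (ρ p / η ^ 2)| * ((η ^ 2)⁻¹ * |fderiv ℝ (fun q => fderiv ℝ ρ q e) p e'|)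
          ≤ Z₁ * ((η ^ 2)⁻¹ * K₂) := by gcongr; exact (hZ _).1
        _ = Z₁ * K₂ / η ^ 2 := by ring
    have hT1 : |deriv (deriv ζ) (ρ p / η ^ 2) * (fderiv ℝ ρ p e' / η ^ 2) *
        ((η ^ 2)⁻¹ * fderiv ℝ ρ p e)| ≤ 4 * Z₂ * K / η ^ 2 := by
      rcases hdich with hρle | ⟨-, h0⟩
      · have hab := abs_mul_abs_le_of_sq_le hK hρ1' hρ1 hρle
        rw [abs_mul, abs_mul, abs_mul, abs_div, abs_inv, abs_of_pos hη2]
        calc |deriv (deriv ζ) (ρ p / η ^ 2)| * (|fderiv ℝ ρ p e'| / η ^ 2) * ((η ^ 2)⁻¹ * |fderiv ℝ ρ p e|)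
            = |deriv (deriv ζ) (ρ p / η ^ 2)| * (|fderiv ℝ ρ p e'| * |fderiv ℝ ρ p e|) / (η ^ 2) ^ 2 := by
              field_simp
          _ ≤ Z₂ * (4 * K * η ^ 2) / (η ^ 2) ^ 2 := by gcongr; exact (hZ _).2
          _ = 4 * Z₂ * K / η ^ 2 := by field_simp
      · rw [h0]; simp only [zero_mul, abs_zero]; positivity
    calc |deriv (deriv ζ) (ρ p / η ^ 2) * (fderiv ℝ ρ p e' / η ^ 2) * ((η ^ 2)⁻¹ * fderiv ℝ ρ p e) +
          deriv ζ (ρ p / η ^ 2) * ((η ^ 2)⁻¹ * fderiv ℝ (fun q => fderiv ℝ ρ q e) p e')|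
        ≤ 4 * Z₂ * K / η ^ 2 + Z₁ * K₂ / η ^ 2 := (abs_add_le _ _).trans (add_le_add hT1 hT2)
      _ = (4 * Z₂ * K + Z₁ * K₂) / η ^ 2 := by ring

end Summit.AtomisticToContinuum.FouriersLaw.Theorems.DrudeDissolution.KineticPolymerGasOnTheTimeAxis

end
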